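import Summits.HodgeConjecture.HodgeConjecture.Cruxes.BlochSeedDiscOne.HeightTower

/-!
line stmt-HodgeConjecture-18881 Cruxes/BlochSeedDiscOne/Lines/birth.lean 814a6a70c14e831a stub_rung_pad4_seedAt

# HallB136 — the HALL ∕ TERM-RANK condition of the two-level block as a typed predicate on `DepthBoundA4.Design`, and the kernel
# certificate that the B136 design VIOLATES it at h = 9 and at h = 14 (hsemireg-semihom-1 g44; (R2)-PREP ∕ audit R19.600–603, candidate omitted constraint H_Hall)

STATUS ∕ SCOPE.  Letter-model statements about `DepthBoundA4.Design` only: a matching count on the weakly-live incidence pattern of a letter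
design ≠ a sheaf ≠ a monad ≠ a SEED ≠ the kernel of STUB R.  NOTHING here is proved toward HC ∕ HC_CM ∕ HC_AV ∕ №4 ∕ 26512 ∕ 18881 ∕ H2, and nothing
here re-decides `Nonex 14 199 8` (REFUTED by `RotatedPairB136.not_nonex_fourteen`, 793039e0aa2d).

THE PREDICATE (memo `CONSTRUCTION-READING-B136-semihom1-g44.md` §7; = hsemireg-monad-2 g6 `R2PREP-BLOCK-READING-B136-monad2-g6.md` §4 «H_Hall»;
= gs-eng-2 g62 «H_TR»).  In the quotient block `0 → ⊕_{(σ,m)∈P} L_σ^{⊕m} —φ→ ⊕_{(τ,n)∈N} L_τ^{⊕n} → 𝓔 → 0` the entry of `φ` at a (P-copy, N-copy) pair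
vanishes identically unless the arrow `σ → τ` is weakly live (`DepthBoundA4.WeakLive`: no DEAD factor; Künneth + the Mumford–Mukai index theorem on
`S = E₀²`).  If `φ` is injective at ONE point then, for every sub-multiset `S` of P-entries, its `Σ m` columns are linearly independent and supported
in the rows of the N-entries weakly live above some entry of `S`; so `Σ_S m ≤ Σ_T n` for every entry list `T ⊇` that neighbourhood
(König–Frobenius–Hall).  `HallUp E` states exactly this family of inequalities, at ENTRY level (sublists of `E.P` ∕ `E.N`; no decidability of cell
equality is needed to state or to refute it).  It is NECESSARY for «some display of the block is fibrewise injective somewhere», hence for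
`coker φ` locally free of rank `Σ_N n − Σ_P m` (pen, two lines above; not formalised — there are no sheaves in this model).

THE DESIGN.  `B136` below is VERBATIM the design `RotatedPairB136.D` (same definitions `cellOf ∕ blk* ∕ prod4 ∕ uN* ∕ vP* ∕ hub4 ∕ DN ∕ DP`, copied
because that module is not yet built on the farm at the time of writing; a successor may add `example : B136 = RotatedPairB136.D := rfl`):
h = 9; N = 8·hub⁴ + Σ_k 16·(ρᵏt)⁴, P = Σ_k (ρᵏu′)^{⊠4}, hub = (9;0,0), t = (2;−4,3), u′ = (0;4,5) + (4;4,1).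

THE CERTIFICATE.  Take `S` = the 60 P-entries whose cell has a letter with `a = 4` (a `ρᵏ(4;4,1)` letter) and `T` = the N-entries weakly live above some
entry of `S`, computed as a filter with the raw test `weakLiveB` (sound: `weakLiveB_of`): `T` has ONE entry, the hub `(hub⁴, 8)`, so the inequality would
read `60 ≤ 8`.  Hence `¬ HallUp B136` (`not_hallUp`).  The same computation on the height-14 shift `shiftD 5 B136` (the audit's fixed object
`NONEX-h14-B136.json` 907bbfc0ca43ab3c: letters (14;0,0), (7;−4,3), (5;4,5), (9;4,1)) gives `¬ HallUp (shiftD 5 B136)` (`not_hallUp_h14`).  Max-flow value (not needed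
for the refutation; recorded for the audit table): term rank 12 = 8 (hub) + 4 (one pure `(ρ^{k+1}(0;4,5))⁴` cell per T-block) against demand 64, deficiency 52 —
three independent stdlib codes (monad-2 g6 `b136_block.py`, gs-eng-2 g62 `b136_rr.py`, semihom-1 g44 `g44_hall.py`).

`decide +kernel` only, on closed Bool ∕ ℕ terms (filters of the 64-entry and 5-entry lists); no `native_decide`, no `sorry`, no `axiom`, no `instance`, no
notation, no Literature fact.  Imports `HeightTower` (for `DepthBoundA4` and `shiftD`).
-/

set_option linter.dupNamespace false
set_option autoImplicit false
set_option maxRecDepth 8192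
set_option maxHeartbeats 4000000

namespace Summit.HodgeConjecture.HodgeConjecture.Cruxes.BlochSeedDiscOne.HallB136

open Summit.HodgeConjecture.HodgeConjecture.Cruxes.BlochSeedDiscOne.DepthBoundA4
open Summit.HodgeConjecture.HodgeConjecture.Cruxes.BlochSeedDiscOne.HeightTower

/-! ## §1 The predicate -/

/-- **H_Hall (UP) for the quotient block of a two-term design**, entry level: for every sub-multiset `S` of P-entries and every list `T` of
N-entries containing each N-entry that is weakly live above some entry of `S`, the column count `Σ_S m` is at most the row count `Σ_T n`.
Necessary for a fibrewise-injective display `⊕P → ⊕N` (König–Hall on the zero pattern forced by the dead Hom's). -/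
def HallUp (E : Design) : Prop :=
  ∀ S : List (Cell × ℕ), S.Sublist E.P →
    ∀ T : List (Cell × ℕ), T.Sublist E.N →
      (∀ cn ∈ E.N, (∃ cm ∈ S, WeakLive cm.1 cn.1) → cn ∈ T) →
        (S.map Prod.snd).sum ≤ (T.map Prod.snd).sum

/-- the instance `S = P`, `T = N` is the rank inequality `Σ_P m ≤ Σ_N n`. -/
theorem sumP_le_sumN_of_hallUp (E : Design) (h : HallUp E) : (E.P.map Prod.snd).sum ≤ (E.N.map Prod.snd).sum :=
  h E.P (List.Sublist.refl _) E.N (List.Sublist.refl _) (fun _ hcn _ => hcn)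

/-! ## §2 Raw tests (as in `RotatedPairB136` §5b) -/

/-- some element passes (tail form). -/
def anyB {α : Type} : List α → (α → Bool) → Bool
  | [], _ => false
  | x :: l, f => match f x with | true => true | false => anyB l f

theorem anyB_iff {α : Type} (l : List α) (f : α → Bool) : anyB l f = true ↔ ∃ x ∈ l, f x = true := by
  induction l with
  | nil => simp [anyB]
  | cons x l ih =>
    simp only [anyB, List.mem_cons, exists_eq_or_imp]
    cases hx : f x <;> simp [ih]

/-- raw NOT-DEAD test (raw form of `NotDead`: equal letters, or `a < a′` with `|dβ|² ≤ Δ²`). -/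
def notDeadB (ℓ ℓ' : Letter) : Bool :=
  (decide (ℓ.a = ℓ'.a) && decide (ℓ.x = ℓ'.x) && decide (ℓ.y = ℓ'.y)) ||
  (decide (ℓ.a < ℓ'.a) && decide ((ℓ'.x - ℓ.x) * (ℓ'.x - ℓ.x) + (ℓ'.y - ℓ.y) * (ℓ'.y - ℓ.y) ≤ (ℓ'.a - ℓ.a) * (ℓ'.a - ℓ.a)))

theorem notDeadB_of {ℓ ℓ' : Letter} (h : NotDead ℓ ℓ') : notDeadB ℓ ℓ' = true := by
  rcases h with h | ⟨ha, hb⟩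
  · subst h
    simp [notDeadB]
  · simp only [notDeadB, Bool.or_eq_true, Bool.and_eq_true, decide_eq_true_eq]
    right
    refine ⟨ha, ?_⟩
    simpa only [pow_two] using hb

/-- raw weakly-live test. -/
def weakLiveB (x y : Cell) : Bool :=
  notDeadB (x 0) (y 0) && notDeadB (x 1) (y 1) && notDeadB (x 2) (y 2) && notDeadB (x 3) (y 3)

theorem weakLiveB_of {x y : Cell} (h : WeakLive x y) : weakLiveB x y = true := by
  simp only [weakLiveB, Bool.and_eq_true]
  exact ⟨⟨⟨notDeadB_of (h 0), notDeadB_of (h 1)⟩, notDeadB_of (h 2)⟩, notDeadB_of (h 3)⟩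

/-! ## §3 The design `B136` (verbatim `RotatedPairB136.D`) -/

/-- a cell from four letters. -/
def cellOf (l₀ l₁ l₂ l₃ : Letter) : Cell := fun f =>
  match f with
  | ⟨0, _⟩ => l₀
  | ⟨1, _⟩ => l₁
  | ⟨2, _⟩ => l₂
  | ⟨_, _⟩ => l₃

/-- level 3: the last slot runs over `u`. -/
def blk3 (u : List (Letter × ℕ)) (a b c : Letter) (m : ℕ) : List (Cell × ℕ) := u.map fun e => (cellOf a b c e.1, m * e.2)
/-- level 2. -/
def blk2 (u : List (Letter × ℕ)) (a b : Letter) (m : ℕ) : List (Cell × ℕ) := u.flatMap fun e => blk3 u a b e.1 (m * e.2)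
/-- level 1. -/
def blk1 (u : List (Letter × ℕ)) (a : Letter) (m : ℕ) : List (Cell × ℕ) := u.flatMap fun e => blk2 u a e.1 (m * e.2)
/-- the product block `u^{⊠4}`. -/
def prod4 (u : List (Letter × ℕ)) : List (Cell × ℕ) := u.flatMap fun e => blk1 u e.1 e.2

/-- the hub cell `(9;0,0)⁴`. -/
def hub4 : Cell := cellOf ⟨9, 0, 0⟩ ⟨9, 0, 0⟩ ⟨9, 0, 0⟩ ⟨9, 0, 0⟩

/-- `u = 2·(2;−4,3)` and its rotations. -/
def uN0 : List (Letter × ℕ) := [(⟨2, -4, 3⟩, 2)]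
def uN1 : List (Letter × ℕ) := [(⟨2, -3, -4⟩, 2)]
def uN2 : List (Letter × ℕ) := [(⟨2, 4, -3⟩, 2)]
def uN3 : List (Letter × ℕ) := [(⟨2, 3, 4⟩, 2)]
/-- `u′ = (0;4,5) + (4;4,1)` and its rotations. -/
def vP0 : List (Letter × ℕ) := [(⟨0, 4, 5⟩, 1), (⟨4, 4, 1⟩, 1)]
def vP1 : List (Letter × ℕ) := [(⟨0, -5, 4⟩, 1), (⟨4, -1, 4⟩, 1)]
def vP2 : List (Letter × ℕ) := [(⟨0, -4, -5⟩, 1), (⟨4, -4, -1⟩, 1)]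
def vP3 : List (Letter × ℕ) := [(⟨0, 5, -4⟩, 1), (⟨4, 1, -4⟩, 1)]

/-- N-list: `8·hub⁴`, then the four rotated blocks `(ρᵏ(2;−4,3))⁴` of multiplicity 16. -/
def DN : List (Cell × ℕ) := (hub4, 8) :: (prod4 uN0 ++ prod4 uN1 ++ prod4 uN2 ++ prod4 uN3)

/-- P-list: the four rotated product blocks of `u′`. -/
def DP : List (Cell × ℕ) := prod4 vP0 ++ prod4 vP1 ++ prod4 vP2 ++ prod4 vP3

/-- the B136 design (= `RotatedPairB136.D`). -/
def B136 : Design := ⟨DN, DP⟩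

/-- bookkeeping: 136 copies, rank 8, 5 + 64 entries. [kernel] -/
theorem B136_copies : B136.copies = 136 ∧ B136.rank = 8 ∧ DN.length = 5 ∧ DP.length = 64 := by decide +kernel

/-! ## §4 The violator at h = 9 -/

/-- a cell carries a letter with `a`-coordinate `a₀` on some factor. -/
def hasA (a₀ : ℤ) (c : Cell) : Bool :=
  decide ((c 0).a = a₀) || decide ((c 1).a = a₀) || decide ((c 2).a = a₀) || decide ((c 3).a = a₀)

/-- `S₆₀`: the P-entries whose cell contains a `ρᵏ(4;4,1)` letter (`a = 4`) — 60 of the 64, each of multiplicity 1. -/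
def S60 : List (Cell × ℕ) := DP.filter fun cm => hasA 4 cm.1

/-- `T₆₀`: the N-entries weakly live above some entry of `S₆₀` (raw test). -/
def T60 : List (Cell × ℕ) := DN.filter fun cn => anyB S60 (fun cm => weakLiveB cm.1 cn.1)

theorem S60_sublist : S60.Sublist B136.P := List.filter_sublist

theorem T60_sublist : T60.Sublist B136.N := List.filter_sublist

/-- demand `Σ_{S₆₀} m = 60`, 60 entries. [kernel] -/
theorem S60_demand : (S60.map Prod.snd).sum = 60 ∧ S60.length = 60 := by decide +kernel

/-- capacity `Σ_{T₆₀} n = 8`: a single entry, of multiplicity 8, whose cell is `hub⁴` letter by letter. [kernel] -/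
theorem T60_capacity : (T60.map Prod.snd).sum = 8 ∧ T60.length = 1 ∧
    anyB T60 (fun cn => !(decide ((cn.1 0) = ⟨9, 0, 0⟩) && decide ((cn.1 1) = ⟨9, 0, 0⟩) &&
      decide ((cn.1 2) = ⟨9, 0, 0⟩) && decide ((cn.1 3) = ⟨9, 0, 0⟩))) = false := by
  decide +kernel

/-- `T₆₀` covers the weakly-live neighbourhood of `S₆₀`. -/
theorem T60_covers : ∀ cn ∈ B136.N, (∃ cm ∈ S60, WeakLive cm.1 cn.1) → cn ∈ T60 := by
  intro cn hcn hex
  obtain ⟨cm, hcm, hw⟩ := hex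
  unfold T60
  exact List.mem_filter.2 ⟨hcn, (anyB_iff _ _).2 ⟨cm, hcm, weakLiveB_of hw⟩⟩

/-- **B136 violates H_Hall**: the 60 P-entries with an `a = 4` letter see only the 8 hub rows (`60 ≤ 8` is false). -/
theorem not_hallUp : ¬ HallUp B136 := by
  intro h
  have h1 := h S60 S60_sublist T60 T60_sublist T60_covers
  rw [S60_demand.1, T60_capacity.1] at h1
  omega

/-! ## §5 The same violator on the height-14 shift (the audit's fixed object) -/

/-- the height-14 object `shiftD 5 B136` (letters (14;0,0), (7;−4,3), (5;4,5), (9;4,1) and rotations). -/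
def B136h14 : Design := shiftD 5 B136

/-- `S₆₀` at height 14: the P-entries whose cell contains a `ρᵏ(9;4,1)` letter (`a = 9`). -/
def S60h14 : List (Cell × ℕ) := B136h14.P.filter fun cm => hasA 9 cm.1

/-- its weakly-live N-neighbourhood. -/
def T60h14 : List (Cell × ℕ) := B136h14.N.filter fun cn => anyB S60h14 (fun cm => weakLiveB cm.1 cn.1)

theorem S60h14_sublist : S60h14.Sublist B136h14.P := List.filter_sublist

theorem T60h14_sublist : T60h14.Sublist B136h14.N := List.filter_sublist

theorem S60h14_demand : (S60h14.map Prod.snd).sum = 60 ∧ S60h14.length = 60 := by decide +kernel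

theorem T60h14_capacity : (T60h14.map Prod.snd).sum = 8 ∧ T60h14.length = 1 := by decide +kernel

theorem T60h14_covers : ∀ cn ∈ B136h14.N, (∃ cm ∈ S60h14, WeakLive cm.1 cn.1) → cn ∈ T60h14 := by
  intro cn hcn hex
  obtain ⟨cm, hcm, hw⟩ := hex
  unfold T60h14
  exact List.mem_filter.2 ⟨hcn, (anyB_iff _ _).2 ⟨cm, hcm, weakLiveB_of hw⟩⟩

/-- **the h = 14 object violates H_Hall** at the same 60 cells. -/
theorem not_hallUp_h14 : ¬ HallUp B136h14 := by
  intro h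
  have h1 := h S60h14 S60h14_sublist T60h14 T60h14_sublist T60h14_covers
  rw [S60h14_demand.1, T60h14_capacity.1] at h1
  omega

end Summit.HodgeConjecture.HodgeConjecture.Cruxes.BlochSeedDiscOne.HallB136
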